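import Literature.NumberTheory.Primality.FellowsKoblitz
import Mathlib.Data.Finset.Sort
import HarnessLib

/-!
# Unique certificates of primality from the Fellows–Koblitz test

Continuation of `FellowsKoblitz.lean` (one line of the test: `FK.TableOK`, `FK.prime_of_entriesOK`,
`FK.entriesOK_unique`, `FK.tableOK_ordTable`, `FK.lt_lcmList_ordTable_sq`) in the format of
`PrattCertificates.lean` (flat lists of proof lines, each prime used justified by some line), with the
one feature Pratt's certificates lack — **uniqueness**: the certificate of a set of primes is a
well-defined function of the set (Fellows–Koblitz 1992, the source of `FACT ∈ UP ∩ coUP`). All in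
the sub-namespace `FK`:

* `FK.Line = ℕ × List ℕ × List ℕ`: `(p, qs, T)` claims "`p` is prime", with `qs` the nondecreasing
  prime factorisation of `p − 1` and `T` the table of orders — for *large* heads (`size p ≥ 1024`);
  small heads (`size p < 1024`, finitely many) carry `qs = T = []` and are checked against the finite
  table of small primes (`FK.LineValid`, `FK.CertValid`, `FK.heads`);
* **soundness** `FK.CertValid.prime_of_mem_heads` (strong induction on the head, as for Pratt);
* the canonical objects: `FK.children p` (the primes a line of `p` refers to), `FK.theLine p`,
  `FK.close p` (the heads of the certificate of `p`: `p` and, recursively, its children),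
  `FK.certHeads S`, **`FK.cert S`** (the certificate of a list `S` of primes: the lines of the sorted
  closure) with `FK.Canonical S ls` (valid, heads strictly increasing, containing `S`, and *minimal*:
  every head is in `S` or is used by some line) and **completeness** `FK.canonical_cert`;
* **uniqueness** `FK.Canonical.unique`: two canonical certificates of the same `S` are equal (every
  valid line is `theLine` of its head — `FK.LineValid.eq_theLine`, by unique factorisation and
  `entriesOK_unique` — and a minimal closed head set is the closure, by a maximal-counterexample
  argument);
* **succinctness** `FK.length_closeF_le`, `FK.length_close_lt` (`|close p| ≤ |Pratt.lines p| < 2 size p`),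
  `FK.length_certHeads_le`, `FK.certHeads_spec`.

## References

* M. R. Fellows, N. Koblitz, *Self-witnessing polynomial-time complexity and prime factorization*,
  Designs, Codes and Cryptography 2 (1992) 231–235, Lemma 1 and Theorem 1 (the certificate: "purported
  prime factorizations `n = ∏ p_j`, `p_j − 1 = ∏ q_k` for each purported prime factor `p_j`, a
  purported prime factorization of each `q_k − 1`, and so on", checked by the algorithm of Lemma 1).
* V. Pratt, *Every prime has a succinct certificate*, SIAM J. Comput. 4 (1975) 214–220.
-/

namespace Literature.NumberTheory.Primality

namespace FK

open Nat

/-! ### Lines, validity, soundness -/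

/-- A proof line `(p, qs, T)`: the claim that `p` is prime, with (for a large head) the nondecreasing
prime factorisation `qs` of `p − 1` and the table `T` of the orders of `2, …, bound p` modulo `p`.
[cite: FellowsKoblitz1992, Theorem 1 (proof)] -/
abbrev Line : Type := ℕ × List ℕ × List ℕ

/-- **Validity of a line** relative to a set `H` of available primes: a *small* head
(`size p < 1024`) must be one of the finitely many small primes and carry no data; a *large* head
must come with the nondecreasing factorisation `qs` of `p − 1` into available primes and a table
passing the Fellows–Koblitz test with `p ≤ (lcm T)²`. [cite: FellowsKoblitz1992, Lemma 1] -/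
def LineValid (H : Set ℕ) (l : Line) : Prop :=
  (l.1.size < 1024 ∧ l.1.Prime ∧ l.2.1 = [] ∧ l.2.2 = []) ∨
  (1024 ≤ l.1.size ∧ List.IsChain (· ≤ ·) l.2.1 ∧ l.2.1.prod = l.1 - 1 ∧ (∀ q ∈ l.2.1, q ∈ H) ∧
    TableOK l.1 l.2.1 l.2.2 ∧ l.1 ≤ lcmList l.2.2 ^ 2)

/-- Validity of a line is monotone in the available primes. [folklore] -/
theorem LineValid.mono {H H' : Set ℕ} (h : H ⊆ H') {l : Line} (hl : LineValid H l) : LineValid H' l := by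
  rcases hl with hl | ⟨h1, h2, h3, h4, h5, h6⟩
  · exact Or.inl hl
  · exact Or.inr ⟨h1, h2, h3, fun q hq => h (h4 q hq), h5, h6⟩

/-- The heads (claimed primes) of a list of lines. [folklore] -/
def heads (ls : List Line) : Set ℕ := {q | ∃ l ∈ ls, l.1 = q}

/-- `heads` is monotone. [folklore] -/
theorem heads_mono {ls ls' : List Line} (h : ls ⊆ ls') : heads ls ⊆ heads ls' :=
  fun _ ⟨l, hl, hq⟩ => ⟨l, h hl, hq⟩

/-- The head of a member is a head. [folklore] -/
theorem mem_heads_of_mem {ls : List Line} {l : Line} (h : l ∈ ls) : l.1 ∈ heads ls := ⟨l, h, rfl⟩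

/-- Heads are the first components. [folklore] -/
theorem mem_heads_iff {ls : List Line} {q : ℕ} : q ∈ heads ls ↔ q ∈ ls.map Prod.fst := by
  simp [heads]

/-- A **valid certificate**: every line is valid with respect to the heads of the certificate itself.
[cite: FellowsKoblitz1992, Theorem 1 (proof)] -/
def CertValid (ls : List Line) : Prop := ∀ l ∈ ls, LineValid (heads ls) l

/-- A valid head is at least `2`. [folklore] -/
theorem LineValid.two_le {H : Set ℕ} {l : Line} (hl : LineValid H l) : 2 ≤ l.1 := by
  rcases hl with ⟨-, hp, -⟩ | ⟨h1, -⟩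
  · exact hp.two_le
  · have : 2 ^ 1 ≤ l.1 := Nat.lt_size.1 (by omega)
    simpa using this

/-- In a valid line every listed `q` is below the head (`q ∣ p − 1`). [folklore] -/
theorem LineValid.lt_of_mem {H : Set ℕ} {l : Line} (hl : LineValid H l) {q : ℕ} (hq : q ∈ l.2.1) :
    q < l.1 := by
  have h2 := hl.two_le
  rcases hl with ⟨-, -, hqs, -⟩ | ⟨-, -, hprod, -⟩
  · rw [hqs] at hq; simp at hq
  · have hq0 : q ≠ 0 := by
      rintro rfl
      have : l.2.1.prod = 0 := List.prod_eq_zero hq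
      omega
    have hdvd : q ∣ l.1 - 1 := hprod ▸ List.dvd_prod hq
    have := Nat.le_of_dvd (by omega) hdvd
    omega

/-- **One line**: a valid line all of whose listed `q` are prime has a prime head (small: by fiat;
large: `prime_of_entriesOK`). [cite: FellowsKoblitz1992, Lemma 1] -/
theorem LineValid.prime {H : Set ℕ} {l : Line} (hl : LineValid H l) (hq : ∀ q ∈ l.2.1, q.Prime) :
    l.1.Prime := by
  have h2 := hl.two_le
  rcases hl with ⟨-, hp, -⟩ | ⟨-, -, hprod, -, hT, hle⟩
  · exact hp
  · exact prime_of_entriesOK h2 hq hprod hT.2 hle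

/-- **Soundness**: every head of a valid certificate is prime (strong induction on the head: the
primes used by a line are smaller heads). [cite: FellowsKoblitz1992, Theorem 1 (proof)] -/
theorem CertValid.prime_of_mem {ls : List Line} (h : CertValid ls) {l : Line} (hl : l ∈ ls) :
    l.1.Prime := by
  suffices key : ∀ n : ℕ, ∀ l ∈ ls, l.1 = n → l.1.Prime from key l.1 l hl rfl
  intro n
  induction n using Nat.strong_induction_on with
  | _ n ih =>
    intro l hl hn
    have hv := h l hl
    refine hv.prime fun q hq => ?_
    rcases hv with ⟨-, -, hqs, -⟩ | ⟨-, -, -, hH, -⟩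
    · rw [hqs] at hq; simp at hq
    · obtain ⟨l', hl', hq'⟩ := hH q hq
      rw [← hq']
      exact ih _ (by rw [hq', ← hn]; exact (h l hl).lt_of_mem hq) l' hl' rfl

/-- Soundness for heads. [cite: FellowsKoblitz1992, Theorem 1 (proof)] -/
theorem CertValid.prime_of_mem_heads {ls : List Line} (h : CertValid ls) {q : ℕ} (hq : q ∈ heads ls) :
    q.Prime := by
  obtain ⟨l, hl, rfl⟩ := hq
  exact h.prime_of_mem hl

/-! ### The canonical line of a prime -/

/-- The primes a line of `p` refers to: none for a small head, the prime factors of `p − 1` (with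
multiplicity, nondecreasing) for a large one. [cite: FellowsKoblitz1992, Theorem 1 (proof)] -/
def children (p : ℕ) : List ℕ := if p.size < 1024 then [] else (p - 1).primeFactorsList

/-- A child is below `p`. [folklore] -/
theorem lt_of_mem_children {p q : ℕ} (hq : q ∈ children p) : q < p := by
  unfold children at hq
  split_ifs at hq
  · simp at hq
  · exact Pratt.lt_of_mem_primeFactorsList_sub_one hq

/-- A child is prime. [folklore] -/
theorem prime_of_mem_children {p q : ℕ} (hq : q ∈ children p) : q.Prime := by
  unfold children at hq
  split_ifs at hq
  · simp at hq
  · exact Nat.prime_of_mem_primeFactorsList hq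

/-- **The canonical line of `p`**: `(p, children p, table)` with the true table `ordTable p` for a
large head and `[]` for a small one. [cite: FellowsKoblitz1992, Theorem 1 (proof)] -/
noncomputable def theLine (p : ℕ) : Line :=
  (p, children p, if p.size < 1024 then [] else ordTable p)

/-- The head of the canonical line. [folklore] -/
@[simp] theorem theLine_fst (p : ℕ) : (theLine p).1 = p := rfl

/-- The listed primes of the canonical line. [folklore] -/
@[simp] theorem theLine_snd_fst (p : ℕ) : (theLine p).2.1 = children p := rfl

/-- **Completeness for one line**: the canonical line of a prime is valid once its children are
available. [cite: FellowsKoblitz1992, Lemma 1] -/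
theorem lineValid_theLine {p : ℕ} (hp : p.Prime) {H : Set ℕ} (hH : ∀ q ∈ children p, q ∈ H) :
    LineValid H (theLine p) := by
  by_cases hs : p.size < 1024
  · left
    exact ⟨hs, hp, by simp [children, hs], by simp [theLine, hs]⟩
  · right
    push Not at hs
    have hch : children p = (p - 1).primeFactorsList := by simp [children, Nat.not_lt.2 hs]
    refine ⟨hs, ?_, ?_, hH, ?_, ?_⟩
    · rw [theLine_snd_fst, hch]; exact Nat.isChain_primeFactorsList _
    · rw [theLine_snd_fst, hch]; exact Nat.prod_primeFactorsList (by have := hp.two_le; omega)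
    · simp only [theLine, Nat.not_lt.2 hs, if_false]
      exact tableOK_ordTable hp hs fun q hq => (prime_of_mem_children hq).two_le
    · simp only [theLine, Nat.not_lt.2 hs, if_false]
      exact (lt_lcmList_ordTable_sq hp hs).le

/-- **Uniqueness for one line**: a valid line over a set of primes is the canonical line of its head
(the factorisation by the fundamental theorem of arithmetic, the table by `entriesOK_unique`).
[cite: FellowsKoblitz1992, Lemma 1 (proof)] -/
theorem LineValid.eq_theLine {H : Set ℕ} (hH : ∀ q ∈ H, q.Prime) {l : Line} (hl : LineValid H l) :
    l = theLine l.1 := by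
  obtain ⟨p, qs, T⟩ := l
  have hprime : p.Prime := hl.prime fun q hq => by
    rcases hl with ⟨-, -, hqs, -⟩ | ⟨-, -, -, hH', -⟩
    · simp only at hqs; rw [hqs] at hq; simp at hq
    · exact hH q (hH' q hq)
  rcases hl with ⟨hs, -, hqs, hT⟩ | ⟨hs, hchain, hprod, hH', hT, -⟩
  · simp only at hs hqs hT
    subst hqs; subst hT
    simp [theLine, children, hs]
  · simp only at hs hchain hprod hH' hT
    have hs' : ¬ p.size < 1024 := Nat.not_lt.2 hs
    have hqs : qs = (p - 1).primeFactorsList := by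
      have hperm := Nat.primeFactorsList_unique hprod fun q hq => hH q (hH' q hq)
      exact hperm.eq_of_sortedLE hchain.sortedLE (Nat.primeFactorsList_sorted _)
    have hT' : T = ordTable p := by
      have h1 := tableOK_ordTable hprime hs (qs := qs) fun q hq => (hH q (hH' q hq)).two_le
      exact entriesOK_unique hprime (fun q hq => hH q (hH' q hq)) hprod hT.2 h1.2
        (by rw [hT.1, h1.1])
    subst hqs; subst hT'
    simp [theLine, children, hs']

/-! ### The closure of a prime and the canonical certificate -/

/-- The heads of the certificate of `p`, with fuel: `p`, then the closures of its children (with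
multiplicity; duplicates are removed later). [cite: FellowsKoblitz1992, Theorem 1 (proof)] -/
noncomputable def closeF : ℕ → ℕ → List ℕ
  | 0, _ => []
  | fuel + 1, p => p :: (children p).flatMap (closeF fuel)

/-- **The closure of `p`**: the primes whose lines the certificate of `p` consists of (fuel `p`
suffices). [cite: FellowsKoblitz1992, Theorem 1 (proof)] -/
noncomputable def close (p : ℕ) : List ℕ := closeF p p

/-- Enough fuel: `closeF fuel p` does not depend on `fuel ≥ p`. [folklore] -/
theorem closeF_eq_of_le : ∀ (fuel : ℕ) {p : ℕ}, p ≤ fuel → 0 < p → closeF fuel p = close p := by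
  suffices key : ∀ (fuel fuel' : ℕ) {p : ℕ}, p ≤ fuel → p ≤ fuel' → 0 < p →
      closeF fuel p = closeF fuel' p from
    fun fuel p h hp => key fuel p h le_rfl hp
  intro fuel
  induction fuel with
  | zero => intro fuel' p h _ hp; omega
  | succ fuel ih =>
    intro fuel' p h h' hp
    obtain ⟨fuel', rfl⟩ : ∃ f, fuel' = f + 1 := ⟨fuel' - 1, by omega⟩
    simp only [closeF, List.cons.injEq, true_and]
    refine List.flatMap_congr fun q hq => ?_
    have hq' := lt_of_mem_children hq
    exact ih fuel' (by omega) (by omega) (prime_of_mem_children hq).pos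

/-- **Unfolding the closure**: `p`, then the closures of its children. [folklore] -/
theorem close_eq {p : ℕ} (hp : 0 < p) : close p = p :: (children p).flatMap close := by
  obtain ⟨n, rfl⟩ : ∃ n, p = n + 1 := ⟨p - 1, by omega⟩
  rw [close, closeF]
  simp only [List.cons.injEq, true_and]
  refine List.flatMap_congr fun q hq => ?_
  exact closeF_eq_of_le n (by have := lt_of_mem_children hq; omega) (prime_of_mem_children hq).pos

/-- `p` is in its closure. [folklore] -/
theorem mem_close_self {p : ℕ} (hp : 0 < p) : p ∈ close p := by
  rw [close_eq hp]; exact List.mem_cons_self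

/-- The closure of a child is part of the closure. [folklore] -/
theorem close_subset_of_mem_children {p q : ℕ} (hq : q ∈ children p) : close q ⊆ close p := by
  have hp : 0 < p := Nat.pos_of_ne_zero (by rintro rfl; simp [children] at hq)
  rw [close_eq hp]
  exact fun r hr => List.mem_cons_of_mem _ (List.mem_flatMap.2 ⟨q, hq, hr⟩)

/-- **Structure of the closure**: a member is `p` itself or a child of some member; every member is
`≤ p`, prime if `p` is, and its children are members. [folklore] -/
theorem close_spec : ∀ {p : ℕ} (_ : 0 < p) {q : ℕ}, q ∈ close p →
    (q = p ∨ ∃ r ∈ close p, q ∈ children r) ∧ q ≤ p ∧ 0 < q ∧ (p.Prime → q.Prime) ∧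
      ∀ r ∈ children q, r ∈ close p := by
  intro p
  induction p using Nat.strong_induction_on with
  | _ p ih =>
    intro hp q hq
    rw [close_eq hp, List.mem_cons, List.mem_flatMap] at hq
    rcases hq with rfl | ⟨c, hc, hq⟩
    · exact ⟨Or.inl rfl, le_rfl, hp, id, fun r hr => close_subset_of_mem_children hr (mem_close_self (prime_of_mem_children hr).pos)⟩
    · have hc' := lt_of_mem_children hc
      have hcp := prime_of_mem_children hc
      obtain ⟨h1, h2, h3, -, h5⟩ := ih c hc' hcp.pos hq
      have hsub := close_subset_of_mem_children hc
      refine ⟨?_, by omega, h3, fun _ => (ih c hc' hcp.pos hq).2.2.2.1 hcp, fun r hr => hsub (h5 r hr)⟩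
      rcases h1 with rfl | ⟨r, hr, hqr⟩
      · exact Or.inr ⟨p, mem_close_self hp, hc⟩
      · exact Or.inr ⟨r, hsub hr, hqr⟩

/-- **Succinctness**: the closure has at most as many members as Pratt's certificate has lines
(the same recursion with fewer children), hence fewer than `2 size p`. [cite: CrandallPomerance1999, Thm 4.1.9] -/
theorem length_closeF_le : ∀ (fuel p : ℕ), (closeF fuel p).length ≤ (Pratt.linesF fuel p).length
  | 0, p => by simp [closeF, Pratt.linesF]
  | fuel + 1, p => by
    simp only [closeF, Pratt.linesF, List.length_cons, List.length_flatMap, add_le_add_iff_right]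
    unfold children
    split_ifs
    · simp
    · have key : ∀ l : List ℕ, (l.map (List.length ∘ closeF fuel)).sum ≤ (l.map (List.length ∘ Pratt.linesF fuel)).sum := by
        intro l
        induction l with
        | nil => simp
        | cons q l ihl =>
          simp only [List.map_cons, List.sum_cons, Function.comp_apply]
          exact Nat.add_le_add (length_closeF_le fuel q) ihl
      exact key _

/-- `|close p| < 2 size p` for a prime `p`. [cite: CrandallPomerance1999, Thm 4.1.9] -/
theorem length_close_lt {p : ℕ} (hp : p.Prime) : (close p).length + 1 < 2 * p.size :=
  lt_of_le_of_lt (Nat.succ_le_succ (length_closeF_le p p)) (Pratt.length_lines_lt hp)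

/-- The heads of the certificate of a list `S` of primes: the sorted union of the closures.
[cite: FellowsKoblitz1992, Theorem 1 (proof)] -/
noncomputable def certHeads (S : List ℕ) : List ℕ := (S.flatMap close).toFinset.sort

/-- Membership in `certHeads`. [folklore] -/
theorem mem_certHeads_iff {S : List ℕ} {q : ℕ} : q ∈ certHeads S ↔ ∃ p ∈ S, q ∈ close p := by
  simp [certHeads, List.mem_flatMap]

/-- `certHeads` is strictly increasing. [folklore] -/
theorem isChain_certHeads (S : List ℕ) : List.IsChain (· < ·) (certHeads S) :=
  (Finset.sortedLT_sort _).isChain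

/-- **Succinctness**: fewer than `Σ_{p ∈ S} 2 size p` heads. [cite: CrandallPomerance1999, Thm 4.1.9] -/
theorem length_certHeads_le {S : List ℕ} (hS : ∀ p ∈ S, p.Prime) :
    (certHeads S).length ≤ (S.map fun p => 2 * p.size).sum := by
  rw [certHeads, Finset.length_sort]
  refine (List.toFinset_card_le _).trans ?_
  induction S with
  | nil => simp
  | cons p S ih =>
    simp only [List.flatMap_cons, List.length_append, List.map_cons, List.sum_cons]
    have h1 := length_close_lt (hS p List.mem_cons_self)
    have h2 := ih fun q hq => hS q (List.mem_cons_of_mem _ hq)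
    omega

/-- Every head is at most the largest element of `S` it comes from, prime, and positive. [folklore] -/
theorem certHeads_spec {S : List ℕ} (hS : ∀ p ∈ S, p.Prime) {q : ℕ} (hq : q ∈ certHeads S) :
    q.Prime ∧ ∃ p ∈ S, q ≤ p := by
  obtain ⟨p, hp, hq⟩ := mem_certHeads_iff.1 hq
  have h := close_spec (hS p hp).pos hq
  exact ⟨h.2.2.2.1 (hS p hp), p, hp, h.2.1⟩

/-- **The certificate of a list of primes**: the canonical lines of its heads.
[cite: FellowsKoblitz1992, Theorem 1 (proof)] -/
noncomputable def cert (S : List ℕ) : List Line := (certHeads S).map theLine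

/-- The heads of `cert S` are `certHeads S`. [folklore] -/
theorem mem_heads_cert_iff {S : List ℕ} {q : ℕ} : q ∈ heads (cert S) ↔ q ∈ certHeads S := by
  rw [mem_heads_iff, cert, List.map_map]
  simp [Function.comp_def]

/-- **Canonical certificates** of a list `S` of numbers: valid, heads strictly increasing, every
member of `S` certified, and minimal — every head is in `S` or is used by some line.
[cite: FellowsKoblitz1992, Theorem 1 (proof)] -/
structure Canonical (S : List ℕ) (ls : List Line) : Prop where
  /-- every line is valid with respect to the heads -/
  valid : CertValid ls
  /-- the heads are listed in strictly increasing order -/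
  chain : List.IsChain (· < ·) (ls.map Prod.fst)
  /-- every member of `S` is a head -/
  contains : ∀ p ∈ S, p ∈ heads ls
  /-- every head is needed -/
  minimal : ∀ l ∈ ls, l.1 ∈ S ∨ ∃ l' ∈ ls, l.1 ∈ l'.2.1

/-- **Completeness**: the certificate of a list of primes is canonical. [cite: FellowsKoblitz1992, Theorem 1 (proof)] -/
theorem canonical_cert {S : List ℕ} (hS : ∀ p ∈ S, p.Prime) : Canonical S (cert S) := by
  refine ⟨fun l hl => ?_, ?_, fun p hp => ?_, fun l hl => ?_⟩
  · obtain ⟨q, hq, rfl⟩ := List.mem_map.1 hl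
    refine lineValid_theLine (certHeads_spec hS hq).1 fun r hr => mem_heads_cert_iff.2 ?_
    obtain ⟨p, hp, hq'⟩ := mem_certHeads_iff.1 hq
    exact mem_certHeads_iff.2 ⟨p, hp, (close_spec (hS p hp).pos hq').2.2.2.2 r hr⟩
  · rw [cert, List.map_map]
    simpa [Function.comp_def] using isChain_certHeads S
  · exact mem_heads_cert_iff.2 (mem_certHeads_iff.2 ⟨p, hp, mem_close_self (hS p hp).pos⟩)
  · obtain ⟨q, hq, rfl⟩ := List.mem_map.1 hl
    obtain ⟨p, hp, hq'⟩ := mem_certHeads_iff.1 hq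
    rcases (close_spec (hS p hp).pos hq').1 with rfl | ⟨r, hr, hqr⟩
    · exact Or.inl (by simpa using hp)
    · refine Or.inr ⟨theLine r, List.mem_map.2 ⟨r, mem_certHeads_iff.2 ⟨p, hp, hr⟩, rfl⟩, ?_⟩
      simpa using hqr

/-- In a canonical certificate over primes, the heads missing from another canonical certificate of
the same `S` are none (maximal counterexample: a missing head is used by a larger line, whose head is
then present on the other side, whose line there is canonical and lists it). [folklore] -/
theorem Canonical.heads_subset {S : List ℕ} {ls ls' : List Line} (h : Canonical S ls) (h' : Canonical S ls') :
    heads ls ⊆ heads ls' := by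
  classical
  have hprime : ∀ q ∈ heads ls, q.Prime := fun q hq => h.valid.prime_of_mem_heads hq
  have hprime' : ∀ q ∈ heads ls', q.Prime := fun q hq => h'.valid.prime_of_mem_heads hq
  by_contra hnot
  rw [Set.not_subset] at hnot
  -- the bad heads, and a maximal one
  set bad := (ls.map Prod.fst).filter (fun q => q ∉ heads ls') with hbad
  have hne : bad.toFinset.Nonempty := by
    obtain ⟨q, hq, hq'⟩ := hnot
    exact ⟨q, List.mem_toFinset.2 (List.mem_filter.2 ⟨mem_heads_iff.1 hq, by simpa using hq'⟩)⟩
  obtain ⟨q, hq, hmax⟩ := Finset.exists_max_image bad.toFinset id hne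
  obtain ⟨hqls, hqls'⟩ := List.mem_filter.1 (List.mem_toFinset.1 hq)
  simp only [decide_eq_true_eq] at hqls'
  obtain ⟨l, hl, rfl⟩ := List.mem_map.1 hqls
  rcases h.minimal l hl with hS | ⟨l', hl', hll'⟩
  · exact hqls' (h'.contains _ hS)
  · -- `l'` is canonical, so `l.1` is a child of `l'.1`, a larger head
    have hl'eq : l' = theLine l'.1 := (h.valid l' hl').eq_theLine hprime
    have hchild : l.1 ∈ children l'.1 := by rw [hl'eq] at hll'; simpa using hll'
    have hlt : l.1 < l'.1 := lt_of_mem_children hchild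
    by_cases hmem : l'.1 ∈ heads ls'
    · -- its line on the other side lists `l.1` among available primes
      obtain ⟨m, hm, hm1⟩ := hmem
      have hmeq : m = theLine m.1 := (h'.valid m hm).eq_theLine hprime'
      have hchild' : l.1 ∈ m.2.1 := by rw [hmeq, theLine_snd_fst, hm1]; exact hchild
      have hv := h'.valid m hm
      rcases hv with ⟨-, -, hqs, -⟩ | ⟨-, -, -, hH, -⟩
      · rw [hqs] at hchild'; simp at hchild'
      · exact hqls' (hH _ hchild')
    · have : l'.1 ∈ bad.toFinset :=
        List.mem_toFinset.2 (List.mem_filter.2 ⟨List.mem_map.2 ⟨l', hl', rfl⟩, by simpa using hmem⟩)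
      exact absurd (hmax _ this) (by simpa using hlt)

/-- **Uniqueness of canonical certificates**: two canonical certificates of the same list are equal
(same head sets by `heads_subset`, same head lists by strict monotonicity, same lines by
`LineValid.eq_theLine`). [cite: FellowsKoblitz1992, Theorem 1 (proof)] -/
theorem Canonical.unique {S : List ℕ} {ls ls' : List Line} (h : Canonical S ls) (h' : Canonical S ls') :
    ls = ls' := by
  have hsub : ls.map Prod.fst ⊆ ls'.map Prod.fst := fun q hq =>
    mem_heads_iff.1 (h.heads_subset h' (mem_heads_iff.2 hq))
  have hsub' : ls'.map Prod.fst ⊆ ls.map Prod.fst := fun q hq =>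
    mem_heads_iff.1 (h'.heads_subset h (mem_heads_iff.2 hq))
  have hfst : ls.map Prod.fst = ls'.map Prod.fst :=
    List.Subset.antisymm_of_sortedLT hsub hsub' h.chain.sortedLT h'.chain.sortedLT
  have hprime : ∀ q ∈ heads ls, q.Prime := fun q hq => h.valid.prime_of_mem_heads hq
  have hprime' : ∀ q ∈ heads ls', q.Prime := fun q hq => h'.valid.prime_of_mem_heads hq
  have e : ls = (ls.map Prod.fst).map theLine := by
    rw [List.map_map]
    conv_lhs => rw [← List.map_id ls]
    exact List.map_congr_left fun l hl => by simpa using (h.valid l hl).eq_theLine hprime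
  have e' : ls' = (ls'.map Prod.fst).map theLine := by
    rw [List.map_map]
    conv_lhs => rw [← List.map_id ls']
    exact List.map_congr_left fun l hl => by simpa using (h'.valid l hl).eq_theLine hprime'
  rw [e, e', hfst]

/-- A canonical certificate of a list of primes is `cert S`. [cite: FellowsKoblitz1992, Theorem 1 (proof)] -/
theorem Canonical.eq_cert {S : List ℕ} (hS : ∀ p ∈ S, p.Prime) {ls : List Line} (h : Canonical S ls) :
    ls = cert S :=
  h.unique (canonical_cert hS)

end FK

end Literature.NumberTheory.Primality
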